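import Mathlib.AlgebraicTopology.FundamentalGroupoid.SimplyConnected
import Mathlib.Analysis.Convex.Contractible
import Literature.Geometry.Manifold.ChartFromFunctions
import HarnessLib

/-!
# Simply connected neighbourhoods with connected sub-level part

Topic `Geometry/Manifold`; namespace `Literature.Geometry.Manifold`. For a `C^∞` manifold `M`
modelled on `ℝ^{d+1} = EuclideanSpace ℝ (Fin (d + 1))` and a real function `f`, `C^∞` on an open
`U ∋ q` with `df_q ≠ 0`, the point `q` has arbitrarily small open neighbourhoods `V ⊆ U` which
are SIMPLY CONNECTED and whose strict sub-level part `V ∩ {f < f q}` is CONNECTED and non-empty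
(`exists_isSimplyConnected_nhds_inter_sublevel_isConnected`): in a chart `φ` of the maximal atlas
whose first coordinate is `f` (`exists_mem_maximalAtlas_apply_zero_eq`, Lee 2013, Thm. 5.12 — the
slice chart of the regular level `{f = f q}`) take `V = φ⁻¹(B)` for a coordinate ball `B`; then
`V ≅ B` is contractible and `V ∩ {f < f q} ≅ B ∩ {x₀ < f q}` is convex. This is the shape of
neighbourhood on which a one-sided local datum (something known on `{f < f q}` near `q`) is fed
to a statement requiring a simply connected domain and a connected sub-domain (e.g. Nomizu's
extension of Killing fields, applied in a chart).

Also: images of simply connected sets under open partial homeomorphisms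
(`isSimplyConnected_image_iff_of_subset_source`), convex sets are simply connected
(`isSimplyConnected_of_convex`, Mathlib's `Convex.contractibleSpace`), and the restriction of a
chart to such a `V` (`isSimplyConnected_restr_target`, `image_restr_source_inter`).
Everything is proved; no definitions, no named facts.

## References

* J. M. Lee, *Introduction to Smooth Manifolds*, 2nd ed., GTM 218, Springer 2013, Thm. 5.12
  (slice charts for regular level sets) and Prop. 1.16 ff. (coordinate balls).
  [LeeSmoothManifolds2013]
-/

noncomputable section

open Set Function Metric
open scoped Manifold ContDiff Topology

namespace Literature.Geometry.Manifold

/-! ### Simply connected sets: convex sets, images under partial homeomorphisms -/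

section Topology

variable {X Y : Type*} [TopologicalSpace X] [TopologicalSpace Y]

/-- **An open partial homeomorphism preserves simple connectivity of subsets of its source**
(its restriction to the source is an embedding, and simple connectivity of a set is a property of
the induced topology, Mathlib's `Topology.IsEmbedding.isSimplyConnected_image`). [folklore] -/
theorem isSimplyConnected_image_iff_of_subset_source (e : OpenPartialHomeomorph X Y) {s : Set X}
    (hs : s ⊆ e.source) : IsSimplyConnected (e '' s) ↔ IsSimplyConnected s := by
  have hemb : Topology.IsEmbedding (e.source.restrict e) := e.isOpenEmbedding_restrict.isEmbedding
  have h1 : e '' s = (e.source.restrict e) '' (Subtype.val ⁻¹' s) := by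
    ext y
    constructor
    · rintro ⟨x, hx, rfl⟩
      exact ⟨⟨x, hs hx⟩, hx, rfl⟩
    · rintro ⟨x, hx, rfl⟩
      exact ⟨x, hx, rfl⟩
  have h2 : (Subtype.val '' (Subtype.val ⁻¹' s : Set e.source)) = s := by
    rw [Subtype.image_preimage_coe, inter_eq_right.2 hs]
  rw [h1, hemb.isSimplyConnected_image, ← Topology.IsEmbedding.subtypeVal.isSimplyConnected_image,
    h2]

/-- **Non-empty convex sets are simply connected** (they are contractible, Mathlib's
`Convex.contractibleSpace`, and contractible spaces are simply connected). [folklore] -/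
theorem isSimplyConnected_of_convex {E : Type*} [AddCommGroup E] [Module ℝ E] [TopologicalSpace E]
    [ContinuousAdd E] [ContinuousSMul ℝ E] {K : Set E} (hK : Convex ℝ K) (hne : K.Nonempty) :
    IsSimplyConnected K := by
  haveI := hK.contractibleSpace hne
  show SimplyConnectedSpace K
  infer_instance

/-- A simply connected set is preconnected. [folklore] -/
theorem isPreconnected_of_isSimplyConnected {s : Set X} (hs : IsSimplyConnected s) :
    IsPreconnected s :=
  hs.isPathConnected.isConnected.isPreconnected

/-- The target of the restriction of an open partial homeomorphism to an open subset `s` of its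
source is the image `e '' s`. [folklore] -/
theorem restr_target_eq_image (e : OpenPartialHomeomorph X Y) {s : Set X} (hs : IsOpen s)
    (hse : s ⊆ e.source) : (e.restr s).target = e '' s := by
  rw [e.restr_target, hs.interior_eq, e.image_eq_target_inter_inv_preimage hse]

/-- **Restricting a chart to a simply connected open subset of its source gives a chart with
simply connected target.** [folklore] -/
theorem isSimplyConnected_restr_target (e : OpenPartialHomeomorph X Y) {s : Set X} (hs : IsOpen s)
    (hse : s ⊆ e.source) (hsc : IsSimplyConnected s) : IsSimplyConnected (e.restr s).target := by
  rw [restr_target_eq_image e hs hse]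
  exact (isSimplyConnected_image_iff_of_subset_source e hse).2 hsc

/-- The image of `(restricted source) ∩ D` under the restricted chart is `e '' (s ∩ D)`.
[folklore] -/
theorem image_restr_source_inter (e : OpenPartialHomeomorph X Y) {s : Set X} (hs : IsOpen s)
    (hse : s ⊆ e.source) (D : Set X) :
    (e.restr s) '' ((e.restr s).source ∩ D) = e '' (s ∩ D) := by
  rw [e.restr_source' s hs, OpenPartialHomeomorph.restr_apply, inter_assoc,
    inter_eq_right.2 (inter_subset_left.trans hse)]

/-- The image of a connected subset of the source under an open partial homeomorphism is
connected. [folklore] -/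
theorem isConnected_image_of_subset_source (e : OpenPartialHomeomorph X Y) {s : Set X}
    (hse : s ⊆ e.source) (hsc : IsConnected s) : IsConnected (e '' s) :=
  hsc.image e (e.continuousOn.mono hse)

end Topology

/-! ### Simply connected neighbourhoods with connected sub-level part -/

section Euclidean

variable {d : ℕ} {M : Type*} [TopologicalSpace M] [ChartedSpace (EuclideanSpace ℝ (Fin (d + 1))) M]
  [IsManifold (𝓡 (d + 1)) ∞ M]

/-- **Simply connected neighbourhoods with connected strict sub-level part.** Let `f` be `C^∞` on
an open `U ∋ q` of a `C^∞` manifold modelled on `ℝ^{d+1}`, with `df_q ≠ 0`. Then there is an open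
`V` with `q ∈ V ⊆ U`, `V` simply connected, and `V ∩ {f < f q}` connected (in particular
non-empty). Proof: in a chart `φ ∈ maximalAtlas` about `q` with first coordinate `f`
(`exists_mem_maximalAtlas_apply_zero_eq`, Lee 2013, Thm. 5.12), `V := φ⁻¹(B)` for a ball
`B ⊆ φ.target` about `φ q`; `V ≅ B` is convex, hence simply connected, and
`V ∩ {f < f q} = φ⁻¹(B ∩ {x₀ < f q})` is the homeomorphic image of a non-empty convex set.
[cite: LeeSmoothManifolds2013, Thm. 5.12] -/
theorem exists_isSimplyConnected_nhds_inter_sublevel_isConnected {U : Set M} (hU : IsOpen U)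
    {f : M → ℝ} (hf : ContMDiffOn (𝓡 (d + 1)) 𝓘(ℝ, ℝ) ∞ f U) {q : M} (hq : q ∈ U)
    (hdf : mfderiv (𝓡 (d + 1)) 𝓘(ℝ, ℝ) f q ≠ 0) :
    ∃ V : Set M, IsOpen V ∧ q ∈ V ∧ V ⊆ U ∧ IsSimplyConnected V ∧
      IsConnected (V ∩ {x | f x < f q}) := by
  set Ed := EuclideanSpace ℝ (Fin (d + 1))
  set φ₀ := chartAt Ed q with hφ₀
  -- the derivative of `f ∘ φ₀⁻¹` at `φ₀ q` is `df_q` read in the chart, hence nonzero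
  have hfa : ContMDiffAt (𝓡 (d + 1)) 𝓘(ℝ, ℝ) ∞ f q := hf.contMDiffAt (hU.mem_nhds hq)
  have hmd : MDifferentiableAt (𝓡 (d + 1)) 𝓘(ℝ, ℝ) f q := hfa.mdifferentiableAt (by simp)
  set O : Set Ed := φ₀.target ∩ φ₀.symm ⁻¹' U with hO
  have hOo : IsOpen O := φ₀.isOpen_inter_preimage_symm hU
  have haO : φ₀ q ∈ O := by
    refine ⟨φ₀.map_source (mem_chart_source Ed q), ?_⟩
    show φ₀.symm (φ₀ q) ∈ U
    rw [φ₀.left_inv (mem_chart_source Ed q)]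
    exact hq
  have hfO : ContDiffOn ℝ ∞ (f ∘ φ₀.symm) O := by
    have h1 : ContMDiffOn 𝓘(ℝ, Ed) 𝓘(ℝ, ℝ) ∞ (f ∘ φ₀.symm) O :=
      hf.comp ((contMDiffOn_chart_symm (I := 𝓡 (d + 1)) (n := ∞) (x := q)).mono
        inter_subset_left) fun z hz ↦ hz.2
    exact contMDiffOn_iff_contDiffOn.1 h1
  have hd : DifferentiableAt ℝ (f ∘ φ₀.symm) (φ₀ q) :=
    (hfO.differentiableOn (by simp) _ haO).differentiableAt (hOo.mem_nhds haO)
  set ℓ : Ed →L[ℝ] ℝ := fderiv ℝ (f ∘ φ₀.symm) (φ₀ q) with hℓ_def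
  have hℓd : HasFDerivAt (f ∘ φ₀.symm) ℓ (φ₀ q) := hd.hasFDerivAt
  have key : mfderiv (𝓡 (d + 1)) 𝓘(ℝ, ℝ) f q = ℓ := by
    rw [hmd.mfderiv, ModelWithCorners.Boundaryless.range_eq_univ, fderivWithin_univ]
    rfl
  have hℓ : ℓ ≠ 0 := by rw [← key]; exact hdf
  -- a chart of the maximal atlas with first coordinate `f`
  obtain ⟨φ, hφ, hqφ, hφU, hφf⟩ := exists_mem_maximalAtlas_apply_zero_eq hU hf hq ℓ hℓ hℓd
  -- a coordinate ball
  obtain ⟨r, hr, hball⟩ := Metric.isOpen_iff.1 φ.open_target (φ q) (φ.map_source hqφ)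
  set K : Set Ed := ball (φ q) r with hK
  set V : Set M := φ.source ∩ φ ⁻¹' K with hV
  have hVeq : V = φ.symm '' K := (φ.symm_image_eq_source_inter_preimage hball).symm
  have hVo : IsOpen V := φ.isOpen_inter_preimage isOpen_ball
  have hqV : q ∈ V := ⟨hqφ, mem_ball_self hr⟩
  refine ⟨V, hVo, hqV, fun x hx ↦ hφU hx.1, ?_, ?_⟩
  · -- `V ≅ K` is simply connected
    rw [hVeq]
    have hKs : K ⊆ φ.symm.source := by rw [φ.symm_source]; exact hball
    exact (isSimplyConnected_image_iff_of_subset_source φ.symm hKs).2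
      (isSimplyConnected_of_convex (convex_ball _ _) ⟨φ q, mem_ball_self hr⟩)
  · -- `V ∩ {f < f q} = φ⁻¹ (K ∩ {x₀ < f q})`
    set c : ℝ := f q with hc
    have heq : V ∩ {x | f x < c} = φ.symm '' (K ∩ {z : Ed | z 0 < c}) := by
      ext x
      constructor
      · rintro ⟨⟨hxs, hxK⟩, hfx⟩
        refine ⟨φ x, ⟨hxK, ?_⟩, φ.left_inv hxs⟩
        show φ x 0 < c
        rw [hφf x hxs]
        exact hfx
      · rintro ⟨z, ⟨hzK, hz⟩, rfl⟩
        have hzt : z ∈ φ.target := hball hzK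
        have hxs : φ.symm z ∈ φ.source := φ.map_target hzt
        refine ⟨⟨hxs, ?_⟩, ?_⟩
        · show φ (φ.symm z) ∈ K
          rw [φ.right_inv hzt]
          exact hzK
        · show f (φ.symm z) < c
          rw [← hφf _ hxs, φ.right_inv hzt]
          exact hz
    rw [heq]
    have hlin : IsLinearMap ℝ (fun z : Ed ↦ z 0) := ⟨fun x y ↦ rfl, fun a x ↦ rfl⟩
    have hconv : Convex ℝ (K ∩ {z : Ed | z 0 < c}) :=
      (convex_ball _ _).inter (convex_halfSpace_lt hlin c)
    -- a point of `K` strictly below the level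
    have h1 : ∀ (v : EuclideanSpace ℝ (Fin (d + 1))) (a : ℝ),
        (v + a • EuclideanSpace.single (0 : Fin (d + 1)) (1 : ℝ)) 0 = v 0 + a := fun v a ↦ by
      simp
    have hz₁ : φ q + (-(r / 2)) • EuclideanSpace.single (0 : Fin (d + 1)) (1 : ℝ) ∈
        K ∩ {z : Ed | z 0 < c} := by
      constructor
      · rw [hK, mem_ball, dist_eq_norm, add_sub_cancel_left, norm_smul, PiLp.norm_single,
          norm_one, mul_one, Real.norm_eq_abs, abs_of_neg (by linarith)]
        linarith
      · show (φ q + (-(r / 2)) • EuclideanSpace.single (0 : Fin (d + 1)) (1 : ℝ)) 0 < c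
        rw [h1, hφf q hqφ]
        linarith
    exact ⟨⟨φ.symm _, mem_image_of_mem _ hz₁⟩,
      hconv.isPreconnected.image _ (φ.continuousOn_symm.mono (inter_subset_left.trans hball))⟩

end Euclidean

end Literature.Geometry.Manifold

end
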